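import Summits.HodgeConjecture.CorCM.MultiFieldWeilPairAdditiveBlocks
import Summits.HodgeConjecture.CorCM.IrreducibleOddWeightsHodgeGluingBlocks
import Literature.AlgebraicGeometry.Pohlmann1968.SimpleCMAbelianVarietyHazamaCriterion
import HarnessLib

/-!
# MULTI-FIELD WEIL ENGINE — HODGE GLUING ALONG BLOCKS WITH ADDITIVE EXCEPTIONAL PAIRS: the CM dress of
# `CorCM/MultiFieldWeilPairAdditiveBlocks.lean` and the block gluing theorem it feeds

Cell `pub-hodgecm2` (COR-CM), seat b30 gen 36 (2026-08-25); count-neutral own lane MULTI-FIELD WEIL ENGINE (stem `MultiFieldWeil*`).  Theorems only; no definition, no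
named fact, no `sorry`.  HONEST FRAMING: an UNCONDITIONAL reduction between instances of the Hodge conjecture for CM abelian varieties (the Hodge conjecture inside the
blocks is a HYPOTHESIS); `HC_CM` is neither used nor asserted.

For realisations `A_i ⊨ (K_i; Φ_i)` (`i ∈ I` finite) and a partition `κ : I ↠ D` of the slots, seat b16's `hodgeConjectureFor_biproduct_of_cmFamilyRank_fiber_add_card_eq`
glues the Hodge conjecture along the blocks as soon as `cmFamilyRank Φ + |D| = Σ_d cmFamilyRank Φ|_{κ = d} + 1` (`Hg(∏_i A_i) = ∏_d Hg(∏_{κ i = d} A_i)`), and seat p2's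
slot criterion (`cmFamilyRank_add_card_eq_of_pairwise_slots_fiber`) supplies that identity when no two slots of different blocks share a constituent.  Here the identity
is supplied under the WEAKER hypothesis of `MultiFieldWeilPairAdditiveBlocks`:

* **`cmFamilyRank_add_card_eq_of_pairwise_or_nondegeneratePair_fiber`** — every ordered cross pair of slots `i, j` (`κ i ≠ κ j`) EITHER has no common constituent
  (`U(Φ_i) ↪̸ U(Φ_j)` in p2's sense), OR the two-member sub-family `(Φ_i, Φ_j)` is NONDEGENERATE (`Hg(A_i × A_j) = Hg(A_i) × Hg(A_j)` of maximal rank) AND every third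
  slot `l` has no common constituent with `U(Φ_i)` or none with `U(Φ_j)` ⟹ `cmFamilyRank Φ + |D| = Σ_d cmFamilyRank Φ|_{κ = d} + 1`;
* **`hodgeConjectureFor_prod_of_blocks_of_pairwise_or_nondegeneratePair`** — under the same hypothesis, the Hodge conjecture for every product of copies of the members
  of each single block implies it for EVERY product of copies `⨁_j A_{π j}`; dominated form.

Typical additive exceptional pair: two simple CM threefolds over `k·F` and `k'·F`, `k ≠ k'` the two imaginary quadratic fields of one Galois closure `k·L_F` — they
share the constituent `χ_k ⊗ std_F` but no imaginary quadratic field, so the pair is nondegenerate (seat b16's census) while p2's slot criterion is silent.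

[cite: MoonenZarhin1999LowDim, §3 (3.1), Remark (3.9)] [cite: Gordon1999HodgeAVSurvey, §3 Theorem (Imai, Murty) with proof, 7.5–7.7] [cite: Deligne1982HodgeCycles, I Ex. 3.7 (c)]
[cite: MumfordAV1970, §19 Thm. 1 and p. 169]

## References
* [MoonenZarhin1999LowDim] B. Moonen, Yu. Zarhin, Math. Ann. 315 (1999) 711–733, §3.  [Gordon1999HodgeAVSurvey] B. B. Gordon, *A survey of the Hodge conjecture for
  abelian varieties*, §3, 7.5–7.7.  [Deligne1982HodgeCycles] P. Deligne, LNM 900 (1982), I Ex. 3.7.  [MumfordAV1970] D. Mumford, *Abelian Varieties*, §19.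
-/

noncomputable section

open scoped BigOperators

open CategoryTheory CategoryTheory.Limits NumberField IntermediateField

namespace Summit.HodgeConjecture.CorCM.MultiFieldWeil

open Literature.NumberTheory.ComplexMultiplication
open Literature.AlgebraicGeometry Literature.AlgebraicGeometry.Motives Literature.AlgebraicGeometry.HodgeTheory
open Literature.AlgebraicGeometry.ComplexMultiplication (IsCMTypeRealisation)
open Literature.AlgebraicTopology.SingularHomology
open Literature.AlgebraicGeometry.Pohlmann1968

open scoped Classical

variable {I : Type} [Fintype I] {K : I → Type} [∀ i, Field (K i)] [∀ i, NumberField (K i)] [∀ i, IsCMField (K i)]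
  {D : Type} [Fintype D]

/-! ## §1 The CM dress of the rank identity -/

omit [∀ i, IsCMField (K i)] in
/-- `|⊔_i Hom(K_i, ℂ)| = Σ_i [K_i : ℚ]`. [folklore] -/
private theorem card_sigma_ringHom_eq_sum_finrank₃₆ {J : Type} [Fintype J] (L : J → Type) [∀ j, Field (L j)] [∀ j, NumberField (L j)] :
    Fintype.card ((j : J) × (L j →+* ℂ)) = ∑ j, Module.finrank ℚ (L j) := by
  rw [Fintype.card_sigma]
  exact Finset.sum_congr rfl fun j _ => Embeddings.card (L j) ℂ

/-- **RANK ADDITIVITY OVER THE BLOCKS, WITH ADDITIVE EXCEPTIONAL PAIRS (CM fields).**  `κ : I ↠ D`; for every ordered cross pair of slots `i, j` (`κ i ≠ κ j`): either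
no non-zero `Aut(ℂ)`-stable `P ≤ U(Φ_i)` maps equivariantly and injectively into `U(Φ_j)`, or the pair sub-family `(Φ_i, Φ_j)` is nondegenerate and every third slot
`l` has no common constituent with `U(Φ_i)` or none with `U(Φ_j)`.  Then `rank((Φ_i)_i) + |D| = Σ_d rank((Φ_i)_{κ i = d}) + 1` — `Hg(∏_i A_i) = ∏_d Hg(∏_{κ i = d} A_i)`.
[cite: MoonenZarhin1999LowDim, §3 (3.1), Remark (3.9)] [cite: Gordon1999HodgeAVSurvey, §3 Theorem (1) (proof)] -/
theorem cmFamilyRank_add_card_eq_of_pairwise_or_nondegeneratePair_fiber [Nonempty I] (Φ : ∀ i, CMType (K i)) (κ : I → D) (hκ : Function.Surjective κ)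
    (hyp : ∀ i j, κ i ≠ κ j →
      (∀ P : Submodule ℚ ((K i →+* ℂ) → ℚ), P ≤ antiSpan (ℂ ≃+* ℂ) (Φ i).1 → (∀ g : ℂ ≃+* ℂ, ∀ f ∈ P, (fun x => f (g • x)) ∈ P) →
        ∀ T : ((K i →+* ℂ) → ℚ) →ₗ[ℚ] ((K j →+* ℂ) → ℚ), (∀ g : ℂ ≃+* ℂ, ∀ f ∈ P, T (fun x => f (g • x)) = fun y => T f (g • y)) →
          (∀ f ∈ P, T f ∈ antiSpan (ℂ ≃+* ℂ) (Φ j).1) → (∀ f ∈ P, T f = 0 → f = 0) → P = ⊥) ∨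
      (CMAlgebra.IsNondegenerateFamily (fun l : {l : I // l = i ∨ l = j} => Φ l.1) ∧
        ∀ l, l ≠ i → l ≠ j →
          (∀ P : Submodule ℚ ((K i →+* ℂ) → ℚ), P ≤ antiSpan (ℂ ≃+* ℂ) (Φ i).1 → (∀ g : ℂ ≃+* ℂ, ∀ f ∈ P, (fun x => f (g • x)) ∈ P) →
            ∀ T : ((K i →+* ℂ) → ℚ) →ₗ[ℚ] ((K l →+* ℂ) → ℚ), (∀ g : ℂ ≃+* ℂ, ∀ f ∈ P, T (fun x => f (g • x)) = fun y => T f (g • y)) →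
              (∀ f ∈ P, T f ∈ antiSpan (ℂ ≃+* ℂ) (Φ l).1) → (∀ f ∈ P, T f = 0 → f = 0) → P = ⊥) ∨
          (∀ P : Submodule ℚ ((K j →+* ℂ) → ℚ), P ≤ antiSpan (ℂ ≃+* ℂ) (Φ j).1 → (∀ g : ℂ ≃+* ℂ, ∀ f ∈ P, (fun x => f (g • x)) ∈ P) →
            ∀ T : ((K j →+* ℂ) → ℚ) →ₗ[ℚ] ((K l →+* ℂ) → ℚ), (∀ g : ℂ ≃+* ℂ, ∀ f ∈ P, T (fun x => f (g • x)) = fun y => T f (g • y)) →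
              (∀ f ∈ P, T f ∈ antiSpan (ℂ ≃+* ℂ) (Φ l).1) → (∀ f ∈ P, T f = 0 → f = 0) → P = ⊥))) :
    CMAlgebra.cmFamilyRank Φ + Fintype.card D = (∑ d, CMAlgebra.cmFamilyRank fun i : {i : I // κ i = d} => Φ i.1) + 1 := by
  classical
  refine typeRank_sigmaType_add_card_eq_of_pairwise_or_jointly_onto_fiber (G := ℂ ≃+* ℂ) (Φ := fun i => (Φ i).1) (fun i => isCMTypeWith_conj (Φ i)) κ hκ
    fun i j hij => ?_
  rcases hyp i j hij with h | ⟨hnd, hiso⟩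
  · exact Or.inl h
  · refine Or.inr ⟨fun a ha b hb => ?_, hiso⟩
    have hne : i ≠ j := fun h => hij (by rw [h])
    -- nondegeneracy of the pair, read as maximal rank of the two-member family type
    have hnd' : typeRank (ℂ ≃+* ℂ) (sigmaType fun l : {l : I // l = i ∨ l = j} => (Φ l.1).1) =
        Fintype.card ((l : {l : I // l = i ∨ l = j}) × (K l.1 →+* ℂ)) / 2 + 1 := by
      rw [card_sigma_ringHom_eq_sum_finrank₃₆ (fun l : {l : I // l = i ∨ l = j} => K l.1)]
      exact hnd
    exact jointlyOnto_of_typeRank_pair_eq (G := ℂ ≃+* ℂ) (Φ := fun i => (Φ i).1) (fun i => isCMTypeWith_conj (Φ i)) hne hnd' a ha b hb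

/-! ## §2 The Hodge conjecture glues along such blocks -/

variable {Φ : ∀ i, CMType (K i)} {A : I → AbelianVariety ℂ} {ι : ∀ i, 𝓞 (K i) →+* End (A i)} {θ : ∀ i, K i →+* Module.End ℂ (complexBetti (A i).X 1)}

/-- **HODGE GLUING ALONG BLOCKS WITH ADDITIVE EXCEPTIONAL PAIRS.**  `A_i ⊨ (K_i; Φ_i)` (`i ∈ I` finite), `κ : I ↠ D`; every ordered cross pair of slots either has no common
constituent or is a nondegenerate pair whose members meet no third slot jointly (as in §1).  IF the Hodge conjecture holds for every product of copies of members of each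
single block, THEN it holds for EVERY product of copies `⨁_j A_{π j}` — UNCONDITIONALLY. [cite: MoonenZarhin1999LowDim, §3 (3.1)]
[cite: Gordon1999HodgeAVSurvey, §3 Theorem (Imai, Murty) with proof, 7.5–7.7] -/
theorem hodgeConjectureFor_prod_of_blocks_of_pairwise_or_nondegeneratePair (hA : ∀ i, IsCMTypeRealisation (Φ i) (A i) (ι i) (θ i)) (κ : I → D)
    (hκ : Function.Surjective κ)
    (hyp : ∀ i j, κ i ≠ κ j →
      (∀ P : Submodule ℚ ((K i →+* ℂ) → ℚ), P ≤ antiSpan (ℂ ≃+* ℂ) (Φ i).1 → (∀ g : ℂ ≃+* ℂ, ∀ f ∈ P, (fun x => f (g • x)) ∈ P) →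
        ∀ T : ((K i →+* ℂ) → ℚ) →ₗ[ℚ] ((K j →+* ℂ) → ℚ), (∀ g : ℂ ≃+* ℂ, ∀ f ∈ P, T (fun x => f (g • x)) = fun y => T f (g • y)) →
          (∀ f ∈ P, T f ∈ antiSpan (ℂ ≃+* ℂ) (Φ j).1) → (∀ f ∈ P, T f = 0 → f = 0) → P = ⊥) ∨
      (CMAlgebra.IsNondegenerateFamily (fun l : {l : I // l = i ∨ l = j} => Φ l.1) ∧
        ∀ l, l ≠ i → l ≠ j →
          (∀ P : Submodule ℚ ((K i →+* ℂ) → ℚ), P ≤ antiSpan (ℂ ≃+* ℂ) (Φ i).1 → (∀ g : ℂ ≃+* ℂ, ∀ f ∈ P, (fun x => f (g • x)) ∈ P) →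
            ∀ T : ((K i →+* ℂ) → ℚ) →ₗ[ℚ] ((K l →+* ℂ) → ℚ), (∀ g : ℂ ≃+* ℂ, ∀ f ∈ P, T (fun x => f (g • x)) = fun y => T f (g • y)) →
              (∀ f ∈ P, T f ∈ antiSpan (ℂ ≃+* ℂ) (Φ l).1) → (∀ f ∈ P, T f = 0 → f = 0) → P = ⊥) ∨
          (∀ P : Submodule ℚ ((K j →+* ℂ) → ℚ), P ≤ antiSpan (ℂ ≃+* ℂ) (Φ j).1 → (∀ g : ℂ ≃+* ℂ, ∀ f ∈ P, (fun x => f (g • x)) ∈ P) →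
            ∀ T : ((K j →+* ℂ) → ℚ) →ₗ[ℚ] ((K l →+* ℂ) → ℚ), (∀ g : ℂ ≃+* ℂ, ∀ f ∈ P, T (fun x => f (g • x)) = fun y => T f (g • y)) →
              (∀ f ∈ P, T f ∈ antiSpan (ℂ ≃+* ℂ) (Φ l).1) → (∀ f ∈ P, T f = 0 → f = 0) → P = ⊥)))
    (hHC : ∀ (d : D) (M : ℕ) (ρ : Fin M → I), (∀ l, κ (ρ l) = d) → HodgeConjectureFor (⨁ fun l => A (ρ l)).dim (⨁ fun l => A (ρ l)).X)
    {N : ℕ} (π : Fin N → I) : HodgeConjectureFor (⨁ fun j => A (π j)).dim (⨁ fun j => A (π j)).X := by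
  cases N with
  | zero => exact hodgeConjectureFor_of_isDivisorGenerated _ (isDivisorGenerated_of_dim_eq_zero _ (dim_biproduct_fin_zero _))
  | succ N =>
    haveI : Nonempty I := ⟨π 0⟩
    refine hodgeConjectureFor_biproduct_of_cmFamilyRank_fiber_add_card_eq κ hκ
      (cmFamilyRank_add_card_eq_of_pairwise_or_nondegeneratePair_fiber Φ κ hκ hyp) hA (fun d J _ _ π' => ?_) π
    -- re-index the `J`-indexed product of members of the block `d` by `Fin |J|`
    let ε : Fin (Fintype.card J) ≃ J := (Fintype.equivFin J).symm
    have hdom : Domination.AVDominatedBy (⨁ fun j => A (π' j).1) (⨁ fun l => A (π' (ε l)).1) :=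
      Domination.AVDominatedBy.of_iso (biproduct.reindex ε fun j => A (π' j).1).symm (Domination.AVDominatedBy.refl _)
    exact Domination.hodgeConjectureFor_of_avDominatedBy (hHC d _ (fun l => (π' (ε l)).1) fun l => (π' (ε l)).2) hdom

/-- **Dominated form.** [cite: MoonenZarhin1999LowDim, §3 (3.1)] [cite: MumfordAV1970, §19 Thm. 1 and p. 169] -/
theorem hodgeConjectureFor_of_avDominatedBy_prod_of_blocks_of_pairwise_or_nondegeneratePair (hA : ∀ i, IsCMTypeRealisation (Φ i) (A i) (ι i) (θ i))
    (κ : I → D) (hκ : Function.Surjective κ)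
    (hyp : ∀ i j, κ i ≠ κ j →
      (∀ P : Submodule ℚ ((K i →+* ℂ) → ℚ), P ≤ antiSpan (ℂ ≃+* ℂ) (Φ i).1 → (∀ g : ℂ ≃+* ℂ, ∀ f ∈ P, (fun x => f (g • x)) ∈ P) →
        ∀ T : ((K i →+* ℂ) → ℚ) →ₗ[ℚ] ((K j →+* ℂ) → ℚ), (∀ g : ℂ ≃+* ℂ, ∀ f ∈ P, T (fun x => f (g • x)) = fun y => T f (g • y)) →
          (∀ f ∈ P, T f ∈ antiSpan (ℂ ≃+* ℂ) (Φ j).1) → (∀ f ∈ P, T f = 0 → f = 0) → P = ⊥) ∨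
      (CMAlgebra.IsNondegenerateFamily (fun l : {l : I // l = i ∨ l = j} => Φ l.1) ∧
        ∀ l, l ≠ i → l ≠ j →
          (∀ P : Submodule ℚ ((K i →+* ℂ) → ℚ), P ≤ antiSpan (ℂ ≃+* ℂ) (Φ i).1 → (∀ g : ℂ ≃+* ℂ, ∀ f ∈ P, (fun x => f (g • x)) ∈ P) →
            ∀ T : ((K i →+* ℂ) → ℚ) →ₗ[ℚ] ((K l →+* ℂ) → ℚ), (∀ g : ℂ ≃+* ℂ, ∀ f ∈ P, T (fun x => f (g • x)) = fun y => T f (g • y)) →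
              (∀ f ∈ P, T f ∈ antiSpan (ℂ ≃+* ℂ) (Φ l).1) → (∀ f ∈ P, T f = 0 → f = 0) → P = ⊥) ∨
          (∀ P : Submodule ℚ ((K j →+* ℂ) → ℚ), P ≤ antiSpan (ℂ ≃+* ℂ) (Φ j).1 → (∀ g : ℂ ≃+* ℂ, ∀ f ∈ P, (fun x => f (g • x)) ∈ P) →
            ∀ T : ((K j →+* ℂ) → ℚ) →ₗ[ℚ] ((K l →+* ℂ) → ℚ), (∀ g : ℂ ≃+* ℂ, ∀ f ∈ P, T (fun x => f (g • x)) = fun y => T f (g • y)) →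
              (∀ f ∈ P, T f ∈ antiSpan (ℂ ≃+* ℂ) (Φ l).1) → (∀ f ∈ P, T f = 0 → f = 0) → P = ⊥)))
    (hHC : ∀ (d : D) (M : ℕ) (ρ : Fin M → I), (∀ l, κ (ρ l) = d) → HodgeConjectureFor (⨁ fun l => A (ρ l)).dim (⨁ fun l => A (ρ l)).X)
    {N : ℕ} (π : Fin N → I) {X : AbelianVariety ℂ} (hX : Domination.AVDominatedBy X (⨁ fun j => A (π j))) : HodgeConjectureFor X.dim X.X :=
  Domination.hodgeConjectureFor_of_avDominatedBy (hodgeConjectureFor_prod_of_blocks_of_pairwise_or_nondegeneratePair hA κ hκ hyp hHC π) hX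

end Summit.HodgeConjecture.CorCM.MultiFieldWeil

end
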